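import Literature.RingTheory.Smooth.ArtinianFormallySmoothField
import Literature.AlgebraicGeometry.Resolution.CoefficientRingsEquichar
import HarnessLib

/-!
# Coefficient fields of Artinian local algebras over a field of characteristic `0`, as algebra structures

Layer `Literature/AlgebraicGeometry/Deformation` (proved lemmas only; no named facts, no `def`, no instance,
no notation).  Setting: `(A, 𝔪, k)` an ARTINIAN local ring — the test rings of deformation theory
([Schlessinger1968] §1) — which is an algebra over a field `K` of characteristic `0` (e.g. `K = ℚ`).

The two inputs are ★ in the tree: (1) ★ `Literature.RingTheory.Smooth.exists_section_residue_of_formallySmooth`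
(Matsumura Thm. 28.3 (ii), NILPOTENT case: if `𝔪` is nilpotent and `k` is formally smooth over `k₀ ⊆ A`, the
residue map has a `k₀`-algebra section — Mathlib `Algebra.FormallySmooth.lift`) and (2) ★
`Literature.AlgebraicGeometry.Resolution.formallySmooth_of_charZero` (EVERY extension of a field of
characteristic `0` is `0`-smooth, Matsumura Thm. 26.9 via a transcendence basis).  This file only DISCHARGES the
formal-smoothness binder of (1) in characteristic `0` and PACKAGES the section the way the consumer types it:

* `isNilpotent_maximalIdeal_of_isArtinianRing` — the maximal ideal of an Artinian local ring is nilpotent;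
* `exists_algHom_residue_comp_eq_id_of_charZero` — `K ⊆ A` a field of characteristic `0`, `𝔪` nilpotent ⇒ a
  `K`-algebra section `σ : k →ₐ[K] A` of `residue` (NO hypothesis on `k/K`: transcendental residue extensions
  allowed); `…_of_isArtinianRing` — the Artinian case;
* `exists_algebra_residueField_section` — packaged: an `Algebra (ResidueField A) A` structure with scalar tower
  `K → k → A` and `residue ∘ algebraMap k A = id`, i.e. `σ(k) ⊂ A` is a COEFFICIENT FIELD in the sense of
  [Lan2013PELCompactifications] Def. B.1.1.1 («`k₀ ⊂ R` is a coefficient field if `k₀` is mapped isomorphically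
  to `k` under `R → R/𝔪 = k`»; existence = Thm. B.1.1.2 / [Matsumura1987] Thm. 28.3 (ii), here without completion
  since `𝔪` is nilpotent);
* `residue_smul_of_section`, `exists_residue_algHom_of_section` — for such a structure the residue map is
  `k`-linear, i.e. an augmentation `A →ₐ[k] k`.

Consumer (cell hodgecm-mathlib, F-11 sub-line `Cruxes/HDel/Lines/F11SmoothRoadA`, join brief job J1 (CF)): the
obstruction theory of smooth schemes along small extensions (`Deformation/SmoothAffineDeformations*`,
`SmoothSchemeLiftObstruction*`) is written over `k`-ALGEBRAS `A′` with an augmentation `A′ →ₐ[k] k`; an Artinian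
local `ℚ`-algebra becomes one for `k := ResidueField A` by `exists_algebra_residueField_section (K := ℚ)`.

## References
* [Lan2013PELCompactifications] K.-W. Lan, *Arithmetic compactifications of PEL-type Shimura varieties*, LMS
  Monographs 36, Princeton UP (2013): App. B.1.1, Def. B.1.1.1 and Thm. B.1.1.2 (p. 586).
* [Matsumura1987] H. Matsumura, *Commutative Ring Theory*, CUP (1986): §28 p. 215, Thm. 28.3 (ii); Thm. 26.9.
* [Schlessinger1968] M. Schlessinger, *Functors of Artin rings*, Trans. AMS 130 (1968) 208–222: §1.
-/

noncomputable section

open IsLocalRing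

namespace Literature.AlgebraicGeometry.Deformation

universe u v

/-! ## Artinian local rings: the maximal ideal is nilpotent -/

section Artinian

variable {A : Type v} [CommRing A] [IsLocalRing A]

/-- The maximal ideal of an Artinian local ring is nilpotent (it is the Jacobson radical, which is nilpotent in
an Artinian ring: Mathlib `IsArtinianRing.isNilpotent_jacobson_bot`). [cite: Schlessinger1968, §1 (p. 209)] -/
theorem isNilpotent_maximalIdeal_of_isArtinianRing [IsArtinianRing A] : IsNilpotent (maximalIdeal A) := by
  have h := IsArtinianRing.isNilpotent_jacobson_bot (R := A)
  rwa [IsLocalRing.jacobson_eq_maximalIdeal ⊥ bot_ne_top] at h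

end Artinian

/-! ## Sections of the residue map in equal characteristic `0` -/

section CharZero

variable {K : Type u} [Field K] [CharZero K] {A : Type v} [CommRing A] [IsLocalRing A] [Algebra K A]

/-- **Coefficient fields in equal characteristic `0`, nilpotent case.**  A local algebra `A` over a field `K` of
characteristic `0` whose maximal ideal is nilpotent has a `K`-algebra section `σ : k → A` of its residue map
(`residue ∘ σ = id`) — with NO hypothesis on the residue extension `k/K`: every field extension in characteristic
`0` is `0`-smooth (★ `Resolution.formallySmooth_of_charZero`, [Matsumura1987] Thm. 26.9), so the nilpotent
lifting ★ `RingTheory.Smooth.exists_section_residue_of_formallySmooth` applies.  `σ(k)` is a coefficient field.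
[cite: Lan2013PELCompactifications, Thm. B.1.1.2 (p. 586)] [cite: Matsumura1987, Thm. 28.3 (ii) (p. 215)] -/
theorem exists_algHom_residue_comp_eq_id_of_charZero (h𝔪 : IsNilpotent (maximalIdeal A)) :
    ∃ σ : ResidueField A →ₐ[K] A, (residue A).comp (σ : ResidueField A →+* A) = RingHom.id _ := by
  haveI : Algebra.FormallySmooth K (ResidueField A) :=
    Literature.AlgebraicGeometry.Resolution.formallySmooth_of_charZero K (ResidueField A)
  obtain ⟨σ, hσ⟩ := Literature.RingTheory.Smooth.exists_section_residue_of_formallySmooth (k₀ := K) h𝔪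
  exact ⟨σ, RingHom.ext hσ⟩

/-- **Coefficient fields of Artinian local algebras over a field of characteristic `0`** (the test rings of
characteristic-`0` deformation theory): the residue map `A → k` has a `K`-algebra section.
[cite: Lan2013PELCompactifications, Thm. B.1.1.2 (p. 586)] [cite: Matsumura1987, Thm. 28.3 (ii) (p. 215)] -/
theorem exists_algHom_residue_comp_eq_id_of_isArtinianRing [IsArtinianRing A] :
    ∃ σ : ResidueField A →ₐ[K] A, (residue A).comp (σ : ResidueField A →+* A) = RingHom.id _ :=
  exists_algHom_residue_comp_eq_id_of_charZero isNilpotent_maximalIdeal_of_isArtinianRing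

/-- **The coefficient field as an algebra structure.**  An Artinian local algebra `A` over a field `K` of
characteristic `0`, with residue field `k`, carries a `k`-algebra structure compatible with the `K`-structure
(scalar tower `K → k → A`) for which the residue map retracts the structure map: `residue ∘ algebraMap k A = id`
— so `A` is an augmented `k`-algebra `k → A → k`, the currency of the small-extension deformation theory
(`Deformation/SmoothAffineDeformations*`); the image of `k` is a coefficient field of `A`
([Lan2013PELCompactifications] Def. B.1.1.1). [cite: Lan2013PELCompactifications, Def. B.1.1.1 and Thm. B.1.1.2 (p. 586)]
[cite: Schlessinger1968, §1 (p. 209)] -/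
theorem exists_algebra_residueField_section [IsArtinianRing A] :
    ∃ (_ : Algebra (ResidueField A) A), IsScalarTower K (ResidueField A) A ∧
      (residue A).comp (algebraMap (ResidueField A) A) = RingHom.id _ := by
  obtain ⟨σ, hσ⟩ := exists_algHom_residue_comp_eq_id_of_isArtinianRing (K := K) (A := A)
  refine ⟨(σ : ResidueField A →+* A).toAlgebra, ?_, hσ⟩
  letI : Algebra (ResidueField A) A := (σ : ResidueField A →+* A).toAlgebra
  exact IsScalarTower.of_algebraMap_eq fun q => (σ.commutes q).symm

end CharZero

/-! ## The augmentation -/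

section Augmentation

variable {A : Type v} [CommRing A] [IsLocalRing A]

/-- Under any algebra structure `k → A` retracted by the residue map (`residue ∘ algebraMap = id`), the residue
map is `k`-linear: `residue (c • a) = c * residue a` — i.e. `residue` is an augmentation of the `k`-algebra `A`.
[cite: Lan2013PELCompactifications, Def. B.1.1.1 (p. 586)] -/
theorem residue_smul_of_section [Algebra (ResidueField A) A]
    (h : (residue A).comp (algebraMap (ResidueField A) A) = RingHom.id _) (c : ResidueField A) (a : A) :
    residue A (c • a) = c * residue A a := by
  rw [Algebra.smul_def, map_mul]
  exact congrArg (· * residue A a) (congr($h c))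

/-- With such a section, `residue` IS a `k`-algebra homomorphism `A →ₐ[k] k` (existence form: there is a
`k`-algebra map whose underlying ring map is `residue A`). [cite: Lan2013PELCompactifications, Def. B.1.1.1 (p. 586)] -/
theorem exists_residue_algHom_of_section [Algebra (ResidueField A) A]
    (h : (residue A).comp (algebraMap (ResidueField A) A) = RingHom.id _) :
    ∃ π : A →ₐ[ResidueField A] ResidueField A, (π : A →+* ResidueField A) = residue A :=
  ⟨{ residue A with commutes' := fun c => congr($h c) }, rfl⟩

end Augmentation

end Literature.AlgebraicGeometry.Deformation

end
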